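import Mathlib
import Summits.PneNP.PneNP.Theses.OverlapGapAlgebra
import Summits.PneNP.PneNP.Theorems.OverlapGapAlgebraNoStableSectionIndep
import Summits.PneNP.PneNP.Theorems.SolvableImpliesStableSection.Negative.FalseWithoutSolvable

/-!
# Crux `SolvableImpliesStableSection` (stmt-PneNP-2463) — negative lemmas, part 3:
# `0 < η` is load-bearing — a FROZEN section fails at every density

Def-free (the crux's hypothesis/conclusion are inlined verbatim).  `concl_false_of_eta_nonpos`: for
`k ≥ 1`, EVERY `α > 0`, `η ≤ 0`, `0 ≤ ν ≤ 1/2` with `h₂(ν) < (1-ν)2^{-k}`, the crux's conclusion at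
`(k, α, η, ν)` is false.  Mechanism (no union over assignments — no `2^n`, no density condition): with
step budget `η n ≤ 0` the section is frozen along the first sweep, `g (Ψ 0) = g (Ψ 1)`
(`frozen_of_stableValid`), so `g (Ψ 0)`, a function of `Ψ 0` alone, must be `ν`-valid for the
INDEPENDENT array `Ψ 1` (`violCount_far_le`); for a fixed assignment at most
`(⌊νm⌋₊+1) e^{m h₂(ν)} e^{-2^{-k}(1-ν)m} · #Inst` arrays qualify (`DartGame.ind_card_violCount_le`), whence
`card_frozenValid_le` and `eventually_frozenMoment_lt` (rate `c = α((1-ν)2^{-k} - h₂(ν))/2`).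
`concl_false_at_eta_zero`: witness `ν = 8^{-k}` for all `k ≥ 1`, `α > 0` (`binEntropy_eighth_pow_lt`).
`solvableImpliesStableSection_false_with_eta_zero_of`: the crux with `0 < η` weakened to `0 ≤ η` is
false as soon as `Solvable(k, α)` holds for SOME `k ≥ 3`, `α > 0` (true in print — Unit Clause, `k = 3`,
`α < 8/3`, Chao–Franco; not yet constructed in the tree's `IsPolyTime` model, so kept as a hypothesis).

For provers: with `…EtaGeOne.lean` (`η ≥ 1`: the crux holds, stability free) this pins the inner end of
the `η`-range: at `η = 0` the conclusion fails even where it is PROVED for every `η > 0` (`α < 2/k`,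
`…PeelingAssembly.lean`).  A valid section must MOVE between the independent sweep endpoints; the
crux's content is exactly the per-step budget `η n`, `0 < η < 1`.  The obstruction is informational
(independence), not geometric.  (Standing disprover gen-2; work file `Cruxes/…/Disproof.lean`.)
-/

set_option linter.dupNamespace false

namespace Summit.PneNP.PneNP.Cruxes.SolvableImpliesStableSection.Negative

open Finset
open Summit.PneNP.PneNP.Cruxes.NoStableSection.DartGame (violCount Inst PathSp splice splice_zero
  splice_full StableValid ind_card_violCount_le)

section Frozen

variable {k m n : ℕ}

/-- **Frozen sections.** With step budget `η n ≤ 0`, on the path event the section is constant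
along every sweep `r` (equal to its value at the sweep's start `Ψ r`). -/
theorem frozen_of_stableValid {η ν : ℝ} (hη : η ≤ 0) {g : Inst m k n → (Fin n → Bool)}
    {Ψ : PathSp k m n} (h : StableValid g η ν Ψ) (r : Fin k) :
    ∀ q ≤ m * k, g (splice Ψ r q) = g (Ψ r.castSucc) := by
  intro q
  induction q with
  | zero =>
      intro _
      rw [splice_zero]
  | succ q ih =>
      intro hq
      have hq' : q < m * k := Nat.lt_of_succ_le hq
      have hstep := h.2 r q hq'
      have hn0 : (0 : ℝ) ≤ n := Nat.cast_nonneg n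
      have hle0 : (hammingDist (g (splice Ψ r q)) (g (splice Ψ r (q + 1))) : ℝ) ≤ 0 :=
        hstep.trans (by nlinarith)
      have hd0 : hammingDist (g (splice Ψ r q)) (g (splice Ψ r (q + 1))) = 0 :=
        Nat.le_zero.1 (by exact_mod_cast hle0)
      rw [← ih hq'.le]
      exact (hammingDist_eq_zero.1 hd0).symm

/-- Hence (`η ≤ 0`, `k ≥ 1`) the value `g (Ψ 0)` is `ν`-valid for the INDEPENDENT far end `Ψ 1`. -/
theorem violCount_far_le (hk : 1 ≤ k) {η ν : ℝ} (hη : η ≤ 0) {g : Inst m k n → (Fin n → Bool)}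
    {Ψ : PathSp k m n} (h : StableValid g η ν Ψ) :
    (violCount (g (Ψ 0)) (Ψ (⟨0, hk⟩ : Fin k).succ) : ℝ) ≤ ν * m := by
  have hc : (⟨0, hk⟩ : Fin k).castSucc = (0 : Fin (k + 1)) := Fin.ext (by simp)
  have hfro := frozen_of_stableValid hη h ⟨0, hk⟩ (m * k) le_rfl
  rw [splice_full, hc] at hfro
  have hval := h.1 ⟨0, hk⟩ (m * k) le_rfl
  simp only [splice_full] at hval
  rw [hfro] at hval
  exact hval

/-- **Counting.** For any `g` and `0 ≤ ν ≤ 1/2`, the paths on which `g (Ψ 0)` violates `≤ ν m`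
clauses of the independent array `Ψ 1` are `≤ (⌊νm⌋₊+1) e^{m h₂(ν)} e^{-2^{-k}(1-ν)m} · #paths`
(fibrewise over `Ψ 0 = a`, `ind_card_violCount_le` for the FIXED assignment `g a`). -/
theorem card_frozenValid_le (hk : 1 ≤ k) {ν : ℝ} (hν0 : 0 ≤ ν) (hν2 : ν ≤ 2⁻¹)
    (g : Inst m k n → (Fin n → Bool)) :
    ((univ.filter fun Ψ : PathSp k m n =>
        (violCount (g (Ψ 0)) (Ψ (⟨0, hk⟩ : Fin k).succ) : ℝ) ≤ ν * m).card : ℝ) ≤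
      ((⌊ν * m⌋₊ + 1) * Real.exp (m * Real.binEntropy ν)) *
        Real.exp (-((1 / 2 : ℝ) ^ k * ((1 - ν) * m))) * Fintype.card (PathSp k m n) := by
  classical
  set r0 : Fin k := ⟨0, hk⟩ with hr0
  set J : ℕ := ⌊ν * m⌋₊ with hJdef
  have hJ : (J : ℝ) ≤ ν * m := Nat.floor_le (by positivity)
  have hJm : J ≤ m := by
    have : (J : ℝ) ≤ m := hJ.trans (by nlinarith [Nat.cast_nonneg (α := ℝ) m])
    exact_mod_cast this
  set B : ℝ := (∑ j ∈ range (J + 1), (m.choose j : ℝ)) * (1 - (1 / 2 : ℝ) ^ k) ^ (m - J) with hB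
  -- the far-end arrays good for the assignment `g a`
  set S : Inst m k n → Finset (Inst m k n) :=
    fun a => univ.filter fun Φ => violCount (g a) Φ ≤ J with hS
  have hScard : ∀ a, ((S a).card : ℝ) ≤ B * Fintype.card (Inst m k n) := fun a =>
    ind_card_violCount_le (g a) J
  have hsub : (univ.filter fun Ψ : PathSp k m n =>
        (violCount (g (Ψ 0)) (Ψ r0.succ) : ℝ) ≤ ν * m) ⊆
      univ.filter fun Ψ : PathSp k m n => Ψ r0.succ ∈ S (Ψ 0) := by
    intro Ψ hΨ
    simp only [mem_filter, mem_univ, true_and, hS] at hΨ ⊢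
    exact Nat.le_floor hΨ
  -- fibrewise over the origin `a = Ψ 0`: the fibre lies in a product set
  have hfib : ∀ a : Inst m k n,
      (((univ.filter fun Ψ : PathSp k m n => Ψ r0.succ ∈ S (Ψ 0)).filter
        fun Ψ => Ψ 0 = a).card : ℝ) ≤ (S a).card * (Fintype.card (Inst m k n) : ℝ) ^ (k - 1) := by
    intro a
    set t : Fin (k + 1) → Finset (Inst m k n) :=
      fun i => if i = 0 then {a} else if i = r0.succ then S a else univ with ht
    have hsub' : ((univ.filter fun Ψ : PathSp k m n => Ψ r0.succ ∈ S (Ψ 0)).filter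
        fun Ψ => Ψ 0 = a) ⊆ Fintype.piFinset t := by
      intro Ψ hΨ
      simp only [mem_filter, mem_univ, true_and] at hΨ
      obtain ⟨hmem, h0⟩ := hΨ
      rw [Fintype.mem_piFinset]
      intro i
      by_cases hi : i = 0
      · subst hi
        simp [ht, h0]
      · by_cases hi' : i = r0.succ
        · subst hi'
          have : t r0.succ = S a := by simp [ht, Fin.succ_ne_zero]
          rw [this, ← h0]
          exact hmem
        · have : t i = univ := by simp [ht, hi, hi']
          rw [this]
          exact mem_univ _
    have hcardt : (Fintype.piFinset t).card = (S a).card * (Fintype.card (Inst m k n)) ^ (k - 1) := by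
      rw [Fintype.card_piFinset, Fin.prod_univ_succ]
      have h0 : (t 0).card = 1 := by simp [ht]
      have hsucc : ∀ j : Fin k, (t j.succ).card =
          if j = r0 then (S a).card else Fintype.card (Inst m k n) := by
        intro j
        by_cases hj : j = r0
        · subst hj
          simp [ht, Fin.succ_ne_zero]
        · have hne : j.succ ≠ r0.succ := fun h => hj (Fin.succ_inj.1 h)
          simp [ht, Fin.succ_ne_zero, hne, hj, card_univ]
      rw [h0, one_mul, prod_congr rfl fun j _ => hsucc j, ← mul_prod_erase univ _ (mem_univ r0)]
      rw [if_pos rfl, prod_congr rfl fun j hj => if_neg (ne_of_mem_erase hj), prod_const,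
        card_erase_of_mem (mem_univ r0), card_univ, Fintype.card_fin]
    exact_mod_cast (card_le_card hsub').trans hcardt.le
  have hcardPaths : (Fintype.card (PathSp k m n) : ℝ) =
      (Fintype.card (Inst m k n) : ℝ) * ((Fintype.card (Inst m k n) : ℝ) *
        (Fintype.card (Inst m k n) : ℝ) ^ (k - 1)) := by
    rw [Fintype.card_fun (α := Fin (k + 1)), Fintype.card_fin]
    push_cast
    rw [← pow_succ', ← pow_succ', Nat.sub_add_cancel hk]
  have hsum0 : 0 ≤ ∑ j ∈ range (J + 1), (m.choose j : ℝ) := sum_nonneg fun _ _ => Nat.cast_nonneg _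
  have hgeom0 : 0 ≤ (1 - (1 / 2 : ℝ) ^ k) ^ (m - J) :=
    pow_nonneg (sub_nonneg.2 (pow_le_one₀ (by norm_num) (by norm_num))) _
  calc ((univ.filter fun Ψ : PathSp k m n =>
        (violCount (g (Ψ 0)) (Ψ r0.succ) : ℝ) ≤ ν * m).card : ℝ)
      ≤ ((univ.filter fun Ψ : PathSp k m n => Ψ r0.succ ∈ S (Ψ 0)).card : ℝ) := by
        exact_mod_cast card_le_card hsub
    _ = ∑ a : Inst m k n, (((univ.filter fun Ψ : PathSp k m n => Ψ r0.succ ∈ S (Ψ 0)).filter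
          fun Ψ => Ψ 0 = a).card : ℝ) := by
        rw [card_eq_sum_card_fiberwise (f := fun Ψ : PathSp k m n => Ψ 0) (t := univ)
          fun _ _ => mem_univ _]
        push_cast
        rfl
    _ ≤ ∑ a : Inst m k n, ((S a).card : ℝ) * (Fintype.card (Inst m k n) : ℝ) ^ (k - 1) :=
        sum_le_sum fun a _ => hfib a
    _ ≤ ∑ _a : Inst m k n, B * Fintype.card (Inst m k n) * (Fintype.card (Inst m k n) : ℝ) ^ (k - 1) := by
        refine sum_le_sum fun a _ => ?_
        exact mul_le_mul_of_nonneg_right (hScard a) (by positivity)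
    _ = B * ((Fintype.card (Inst m k n) : ℝ) * ((Fintype.card (Inst m k n) : ℝ) *
          (Fintype.card (Inst m k n) : ℝ) ^ (k - 1))) := by
        rw [sum_const, card_univ, nsmul_eq_mul]
        ring
    _ = B * Fintype.card (PathSp k m n) := by rw [hcardPaths]
    _ ≤ ((J + 1) * Real.exp (m * Real.binEntropy ν)) *
          Real.exp (-((1 / 2 : ℝ) ^ k * ((1 - ν) * m))) * Fintype.card (PathSp k m n) := by
        refine mul_le_mul_of_nonneg_right ?_ (Nat.cast_nonneg _)
        have hS' := sum_choose_le_exp_binEntropy (m := m) hν0 hν2 hJ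
        have hG : (1 - (1 / 2 : ℝ) ^ k) ^ (m - J) ≤ Real.exp (-((1 / 2 : ℝ) ^ k * ((1 - ν) * m))) := by
          refine (one_sub_pow_le_exp hJm).trans (Real.exp_le_exp.2 ?_)
          have hp0 : 0 ≤ (1 / 2 : ℝ) ^ k := by positivity
          nlinarith
        rw [hB]
        gcongr
    _ = _ := by ring

end Frozen

section Analytic

variable {k : ℕ}

/-- **Analytic comparison (no `2^n`).** If `c < α ((1-ν) 2^{-k} - h₂(ν))` then eventually
`(⌊ν m⌋₊ + 1) e^{m h₂(ν)} e^{-2^{-k}(1-ν) m} < e^{-cn}` for `m = ⌊α n⌋₊` — at EVERY density `α > 0`. -/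
theorem eventually_frozenMoment_lt {α ν c : ℝ} (hα : 0 < α) (hν0 : 0 ≤ ν) (hν1 : ν ≤ 1)
    (hrate : c < α * ((1 - ν) * (1 / 2) ^ k - Real.binEntropy ν)) :
    ∀ᶠ n : ℕ in Filter.atTop,
      ((⌊ν * ⌊α * n⌋₊⌋₊ + 1) * Real.exp (⌊α * n⌋₊ * Real.binEntropy ν)) *
        Real.exp (-((1 / 2 : ℝ) ^ k * ((1 - ν) * ⌊α * n⌋₊))) < Real.exp (-(c * n)) := by
  set R : ℝ := (1 - ν) * (1 / 2) ^ k - Real.binEntropy ν with hR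
  set γ : ℝ := α * R - c with hγ
  have hγpos : 0 < γ := by rw [hγ]; linarith
  set C : ℝ := Real.log (α + 1) + |R| with hC
  have hC0 : 0 ≤ C := by
    have h1 : 0 ≤ Real.log (α + 1) := Real.log_nonneg (by linarith)
    have h2 : 0 ≤ |R| := abs_nonneg R
    linarith
  filter_upwards [eventually_log_le_mul (show 0 < γ / 4 by positivity),
    Filter.eventually_ge_atTop (⌈C * (4 / γ)⌉₊ + 1)] with n hlog hn
  have hn1 : (1 : ℝ) ≤ n := by exact_mod_cast le_trans (Nat.le_add_left 1 _) hn
  have hnpos : (0 : ℝ) < n := by linarith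
  -- the number of clauses `M = ⌊α n⌋₊` satisfies `α n - 1 < M ≤ α n`
  set M : ℕ := ⌊α * (n : ℝ)⌋₊ with hM
  have hMle : (M : ℝ) ≤ α * n := Nat.floor_le (by positivity)
  have hMgt : α * n - 1 < M := by
    have := Nat.lt_floor_add_one (α * (n : ℝ))
    linarith
  have hM0 : (0 : ℝ) ≤ M := Nat.cast_nonneg M
  have hJle : (⌊ν * (M : ℝ)⌋₊ : ℝ) + 1 ≤ (α + 1) * n := by
    have h1 : (⌊ν * (M : ℝ)⌋₊ : ℝ) ≤ ν * M := Nat.floor_le (by positivity)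
    have h2 : ν * (M : ℝ) ≤ M := by nlinarith
    nlinarith
  have hMR : -((M : ℝ) * R) ≤ -(α * R * n) + |R| := by
    rcases le_or_gt 0 R with hR0 | hR0
    · rw [abs_of_nonneg hR0]
      nlinarith
    · rw [abs_of_neg hR0]
      nlinarith
  have hconst : C ≤ γ / 4 * n := by
    have h1 : ((⌈C * (4 / γ)⌉₊ : ℕ) : ℝ) + 1 ≤ n := by exact_mod_cast hn
    have h2 : C * (4 / γ) ≤ ⌈C * (4 / γ)⌉₊ := Nat.le_ceil _
    have h3 : C * (4 / γ) ≤ n := by linarith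
    have h4 := mul_le_mul_of_nonneg_right h3 (show 0 ≤ γ / 4 by positivity)
    have h5 : C * (4 / γ) * (γ / 4) = C := by field_simp
    linarith
  have hγn : 0 < γ * n := mul_pos hγpos hnpos
  have hJexp : (⌊ν * (M : ℝ)⌋₊ : ℝ) + 1 ≤ Real.exp (Real.log (α + 1) + Real.log n) := by
    rw [Real.exp_add, Real.exp_log (by positivity), Real.exp_log hnpos]
    exact hJle
  have hJ0 : (0 : ℝ) ≤ (⌊ν * (M : ℝ)⌋₊ : ℝ) + 1 := by positivity
  calc (((⌊ν * (M : ℝ)⌋₊ : ℝ) + 1) * Real.exp (M * Real.binEntropy ν)) *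
        Real.exp (-((1 / 2 : ℝ) ^ k * ((1 - ν) * M)))
      ≤ (Real.exp (Real.log (α + 1) + Real.log n) * Real.exp (M * Real.binEntropy ν)) *
          Real.exp (-((1 / 2 : ℝ) ^ k * ((1 - ν) * M))) := by gcongr
    _ = Real.exp ((Real.log (α + 1) + Real.log n) - M * R) := by
        rw [← Real.exp_add, ← Real.exp_add]
        congr 1
        rw [hR]
        ring
    _ < Real.exp (-(c * n)) := Real.exp_lt_exp.2 (by linarith)

/-- `h₂(8^{-k}) < (1 - 8^{-k})·2^{-k}` for `k ≥ 1` (`h₂(ν) ≤ ν(log ν⁻¹ + 1)`, `4^k ≥ 1 + 3k`). -/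
theorem binEntropy_eighth_pow_lt (hk : 1 ≤ k) :
    Real.binEntropy ((1 / 8 : ℝ) ^ k) < (1 - (1 / 8 : ℝ) ^ k) * (1 / 2 : ℝ) ^ k := by
  set x : ℝ := (1 / 2 : ℝ) ^ k with hx
  set ν : ℝ := (1 / 8 : ℝ) ^ k with hνdef
  have hx0 : 0 < x := by positivity
  have hx2 : x ≤ 1 / 2 := by
    have h := pow_le_pow_of_le_one (show (0 : ℝ) ≤ 1 / 2 by norm_num) (by norm_num) hk
    rw [pow_one] at h
    exact h
  have hνx : ν = x ^ 3 := by
    rw [hνdef, hx, ← pow_mul, mul_comm k 3, pow_mul]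
    norm_num
  have hν0 : 0 < ν := by positivity
  have hν8 : ν ≤ 1 / 8 := by
    have h := pow_le_pow_of_le_one (show (0 : ℝ) ≤ 1 / 8 by norm_num) (by norm_num) hk
    rw [pow_one] at h
    exact h
  have h1ν : 0 < 1 - ν := by linarith
  -- Bernoulli: `x² (1 + 3k) ≤ 1`
  have hx2eq : x ^ 2 * (4 : ℝ) ^ k = 1 := by
    rw [hx, ← pow_mul, mul_comm k 2, pow_mul, ← mul_pow]
    norm_num
  have hBern : x ^ 2 * (1 + 3 * k) ≤ 1 := by
    have h4 : (1 : ℝ) + (k : ℝ) * 3 ≤ (1 + 3) ^ k := one_add_mul_le_pow (by norm_num) k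
    have h4' : (1 : ℝ) + 3 * k ≤ (4 : ℝ) ^ k := by norm_num at h4 ⊢; linarith
    calc x ^ 2 * (1 + 3 * k) ≤ x ^ 2 * (4 : ℝ) ^ k :=
          mul_le_mul_of_nonneg_left h4' (sq_nonneg x)
      _ = 1 := hx2eq
  -- the entropy estimate `h₂ ν ≤ ν (3k log 2) + ν`
  have hinv : ν⁻¹ = (2 : ℝ) ^ (3 * k) := by
    rw [hνdef, ← inv_pow, pow_mul]
    norm_num
  have hlog1 : Real.log ν⁻¹ = 3 * k * Real.log 2 := by
    rw [hinv, Real.log_pow]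
    push_cast
    ring
  have hlog2' : Real.log (1 - ν)⁻¹ ≤ (1 - ν)⁻¹ - 1 := Real.log_le_sub_one_of_pos (inv_pos.2 h1ν)
  have hterm : (1 - ν) * Real.log (1 - ν)⁻¹ ≤ ν := by
    calc (1 - ν) * Real.log (1 - ν)⁻¹ ≤ (1 - ν) * ((1 - ν)⁻¹ - 1) :=
          mul_le_mul_of_nonneg_left hlog2' h1ν.le
      _ = ν := by rw [mul_sub, mul_inv_cancel₀ h1ν.ne', mul_one]; ring
  have hent : Real.binEntropy ν ≤ ν * (3 * k * Real.log 2) + ν := by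
    rw [Real.binEntropy, hlog1]
    linarith
  -- numerics: `ν (3k log 2 + 1) < (1 - ν) x` with `ν = x³`, `x ≤ 1/2`, `x²(1+3k) ≤ 1`
  have hlog2 : Real.log 2 < 0.6931471808 := Real.log_two_lt_d9
  have hk0 : (0 : ℝ) ≤ k := Nat.cast_nonneg k
  have hxsq : x ^ 2 ≤ 1 / 4 := by nlinarith
  have hkx : 0 ≤ (k : ℝ) * x ^ 2 := by positivity
  have hmain : x ^ 2 * (3 * k * Real.log 2 + 1) < 1 - x ^ 3 := by nlinarith
  calc Real.binEntropy ν ≤ ν * (3 * k * Real.log 2) + ν := hent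
    _ = x * (x ^ 2 * (3 * k * Real.log 2 + 1)) := by rw [hνx]; ring
    _ < x * (1 - x ^ 3) := mul_lt_mul_of_pos_left hmain hx0
    _ = (1 - ν) * x := by rw [hνx]; ring

end Analytic

section Main

variable {k : ℕ}

/-- **The crux's conclusion is false for frozen sections, at every density:** `k ≥ 1`, `α > 0`,
`η ≤ 0`, `0 ≤ ν ≤ 1/2`, `h₂(ν) < (1-ν)2^{-k}` ⇒ the consequent of `SolvableImpliesStableSection` at
`(k, α, η, ν)` (inlined verbatim) fails, with rate `c = α((1-ν)2^{-k} - h₂(ν))/2`. -/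
theorem concl_false_of_eta_nonpos (hk : 1 ≤ k) {α η ν : ℝ} (hα : 0 < α) (hη : η ≤ 0)
    (hν0 : 0 ≤ ν) (hν2 : ν ≤ 2⁻¹) (hR : Real.binEntropy ν < (1 - ν) * (1 / 2 : ℝ) ^ k) :
    ¬ (∀ c : ℝ, 0 < c → ∃ᶠ n : ℕ in Filter.atTop, ∀ m : ℕ, m = ⌊α * n⌋₊ →
      ∃ g : (Fin m → Fin k → Fin n × Bool) → (Fin n → Bool),
        Real.exp (-(c * n)) * Fintype.card (Fin (k + 1) → Fin m → Fin k → Fin n × Bool) ≤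
        ((Finset.univ.filter fun Ψ : Fin (k + 1) → Fin m → Fin k → Fin n × Bool =>
          let P : Fin k → ℕ → Fin m → Fin k → Fin n × Bool :=
            fun r q a b => if (a : ℕ) * k + b < q then Ψ r.succ a b else Ψ r.castSucc a b
          (∀ r : Fin k, ∀ q ≤ m * k, ((Finset.univ.filter fun i : Fin m =>
            ∀ j, g (P r q) (P r q i j).1 ≠ (P r q i j).2).card : ℝ) ≤ ν * m) ∧
          ∀ r : Fin k, ∀ q < m * k,
            (hammingDist (g (P r q)) (g (P r (q + 1))) : ℝ) ≤ η * n).card : ℝ)) := by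
  intro hC
  set c : ℝ := α * ((1 - ν) * (1 / 2 : ℝ) ^ k - Real.binEntropy ν) / 2 with hc
  have hpos : 0 < α * ((1 - ν) * (1 / 2 : ℝ) ^ k - Real.binEntropy ν) := mul_pos hα (by linarith)
  have hc0 : 0 < c := by rw [hc]; linarith
  have hrate : c < α * ((1 - ν) * (1 / 2 : ℝ) ^ k - Real.binEntropy ν) := by rw [hc]; linarith
  have hν1 : ν ≤ 1 := hν2.trans (by norm_num)
  obtain ⟨n, hn, hlt, hn1⟩ := ((hC c hc0).and_eventually
    ((eventually_frozenMoment_lt (k := k) hα hν0 hν1 hrate).and (Filter.eventually_ge_atTop 1))).exists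
  obtain ⟨g, hg⟩ := hn _ rfl
  have hcard := card_paths_pos k ⌊α * (n : ℝ)⌋₊ hn1
  have hle := card_frozenValid_le (k := k) (m := ⌊α * (n : ℝ)⌋₊) (n := n) hk hν0 hν2 g
  refine absurd hg (not_le.2 (lt_of_le_of_lt (le_trans ?_ hle) (mul_lt_mul_of_pos_right hlt hcard)))
  exact_mod_cast Finset.card_le_card fun Ψ hΨ => by
    simp only [Finset.mem_filter, Finset.mem_univ, true_and] at hΨ ⊢
    exact violCount_far_le hk hη hΨ

/-- **Witness `(k, α, 0, 8^{-k})`:** for every `k ≥ 1`, `α > 0` the crux's conclusion fails at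
`η = 0`, `ν = 8^{-k}` (yet for every `η > 0` it is a theorem below density `2/k`). -/
theorem concl_false_at_eta_zero (hk : 1 ≤ k) {α : ℝ} (hα : 0 < α) :
    ¬ (∀ c : ℝ, 0 < c → ∃ᶠ n : ℕ in Filter.atTop, ∀ m : ℕ, m = ⌊α * n⌋₊ →
      ∃ g : (Fin m → Fin k → Fin n × Bool) → (Fin n → Bool),
        Real.exp (-(c * n)) * Fintype.card (Fin (k + 1) → Fin m → Fin k → Fin n × Bool) ≤
        ((Finset.univ.filter fun Ψ : Fin (k + 1) → Fin m → Fin k → Fin n × Bool =>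
          let P : Fin k → ℕ → Fin m → Fin k → Fin n × Bool :=
            fun r q a b => if (a : ℕ) * k + b < q then Ψ r.succ a b else Ψ r.castSucc a b
          (∀ r : Fin k, ∀ q ≤ m * k, ((Finset.univ.filter fun i : Fin m =>
            ∀ j, g (P r q) (P r q i j).1 ≠ (P r q i j).2).card : ℝ) ≤ (1 / 8 : ℝ) ^ k * m) ∧
          ∀ r : Fin k, ∀ q < m * k,
            (hammingDist (g (P r q)) (g (P r (q + 1))) : ℝ) ≤ 0 * n).card : ℝ)) := by
  have hν8 : (1 / 8 : ℝ) ^ k ≤ 2⁻¹ := by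
    have h := pow_le_pow_of_le_one (show (0 : ℝ) ≤ 1 / 8 by norm_num) (by norm_num) hk
    rw [pow_one] at h
    exact h.trans (by norm_num)
  exact concl_false_of_eta_nonpos hk hα le_rfl (by positivity) hν8 (binEntropy_eighth_pow_lt hk)

/-- **`0 < η` is load-bearing (modulo solvability anywhere):** the crux with `0 < η` weakened to
`0 ≤ η` is false once its hypothesis holds at SOME `k ≥ 3`, `α > 0` (true in print: Unit Clause,
`k = 3`, `α < 8/3`; not yet constructed in the tree's `IsPolyTime` model, hence a hypothesis). -/
theorem solvableImpliesStableSection_false_with_eta_zero_of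
    (H : ∃ k : ℕ, 3 ≤ k ∧ ∃ α : ℝ, 0 < α ∧ ∃ f : List Bool → List Bool,
      Literature.Computability.Complexity.IsPolyTime f ∧ ∃ ε : ℝ, 0 < ε ∧
        ∃ᶠ n : ℕ in Filter.atTop, ∀ m : ℕ, m = ⌊α * n⌋₊ → ε ≤
          ((Finset.univ.filter fun Φ : Fin m → Fin k → Fin n × Bool => ∀ i, ∃ j,
            (f (Literature.Computability.Complexity.encodingCNF.encode (List.ofFn fun a =>
              List.ofFn fun b => (((Φ a b).1 : ℕ), (Φ a b).2)))).getD (Φ i j).1 false =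
                (Φ i j).2).card : ℝ) / Fintype.card (Fin m → Fin k → Fin n × Bool)) :
    ¬ (∀ k : ℕ, 3 ≤ k → ∀ α η ν : ℝ, 0 < α → 0 ≤ η → 0 < ν →
      (∃ f : List Bool → List Bool, Literature.Computability.Complexity.IsPolyTime f ∧
        ∃ ε : ℝ, 0 < ε ∧ ∃ᶠ n : ℕ in Filter.atTop, ∀ m : ℕ, m = ⌊α * n⌋₊ → ε ≤
          ((Finset.univ.filter fun Φ : Fin m → Fin k → Fin n × Bool => ∀ i, ∃ j,
            (f (Literature.Computability.Complexity.encodingCNF.encode (List.ofFn fun a =>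
              List.ofFn fun b => (((Φ a b).1 : ℕ), (Φ a b).2)))).getD (Φ i j).1 false =
                (Φ i j).2).card : ℝ) / Fintype.card (Fin m → Fin k → Fin n × Bool)) →
      ∀ c : ℝ, 0 < c → ∃ᶠ n : ℕ in Filter.atTop, ∀ m : ℕ, m = ⌊α * n⌋₊ →
        ∃ g : (Fin m → Fin k → Fin n × Bool) → (Fin n → Bool),
          Real.exp (-(c * n)) * Fintype.card (Fin (k + 1) → Fin m → Fin k → Fin n × Bool) ≤
          ((Finset.univ.filter fun Ψ : Fin (k + 1) → Fin m → Fin k → Fin n × Bool =>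
            let P : Fin k → ℕ → Fin m → Fin k → Fin n × Bool :=
              fun r q a b => if (a : ℕ) * k + b < q then Ψ r.succ a b else Ψ r.castSucc a b
            (∀ r : Fin k, ∀ q ≤ m * k, ((Finset.univ.filter fun i : Fin m =>
              ∀ j, g (P r q) (P r q i j).1 ≠ (P r q i j).2).card : ℝ) ≤ ν * m) ∧
            ∀ r : Fin k, ∀ q < m * k,
              (hammingDist (g (P r q)) (g (P r (q + 1))) : ℝ) ≤ η * n).card : ℝ)) := by
  intro hW
  obtain ⟨k, hk, α, hα, hsolv⟩ := H
  exact concl_false_at_eta_zero (k := k) (by omega) hα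
    (hW k hk α 0 ((1 / 8 : ℝ) ^ k) hα le_rfl (by positivity) hsolv)

end Main

end Summit.PneNP.PneNP.Cruxes.SolvableImpliesStableSection.Negative
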